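import Mathlib
import HarnessLib
import Literature.Computability.AlgebraicComplexity.ArithCircuit
import Literature.Computability.AlgebraicComplexity.ArithCircuitProofs
import Literature.Computability.AlgebraicComplexity.SupportSymmetrisation

/-!
# ValiantsHypothesis / MonotoneRestoration — `MonotoneRestorationQP`, line `Sketch`, stub D4 (1/3)

Support file for crux item `stmt-ValiantsHypothesis-15886`
(`Summit.ValiantsHypothesis.ValiantsHypothesis.Theses.MonotoneRestoration.MonotoneRestorationQP`),
line `Sketch`, stub `stub_rowScan_program` (Theorem δ, the GLOBAL BLOCK of the scan program):
generic lemmas for extending an ANNOTATED straight-line program one gate at a time.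

A gate list `G` over `ℂ` on the `n × n` variable matrix with a support annotation
`K' : ℕ → Finset (Fin n)` is *admissible* (the hypothesis format of
`SupportSymm.exists_symmetric_circuit_of_supports`) when its gates are non-nullary, of fan-in
`≤ B`, refer only to earlier gates, product gates take only operands supported inside their own
support, and the value of gate `i` is invariant under the diagonal renamings fixing `K' i`
pointwise. This five-part conjunction is spelled out verbatim in every statement below (no new
definitions). The lemmas: appending one gate whose index carries the empty support keeps
admissibility (`rowScanProg_inv_step`); hence one more gate *provides* — at an index `≥ l₀`,
where all supports are empty — a weighted sum of provided values (`rowScanProg_provide_wsum`), a product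
of two provided values (`rowScanProg_provide_prod`), a constant (`rowScanProg_provide_const`), or
an invariant weighted sum of arbitrary earlier gates (`rowScanProg_provide_sum`); and finitely many
such one-gate steps compose (`rowScanProg_provide_family`, stated for an arbitrary persistent
notion of "provided"). Every sum gate carries a dummy operand `0 • (const 0)` so that it is never
nullary.

References: P. Bürgisser, *Completeness and Reduction in Algebraic Complexity Theory*, Springer
2000, Def. 2.1 (straight-line programs); A. Dawar, G. Wilsenach, *Symmetric Arithmetic Circuits*,
ToC 2025 (supports).
-/

-- `Summit.ValiantsHypothesis.ValiantsHypothesis.…` is the tree's mandated single-conjunct layout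
-- (Sub = Summit), so the duplicated namespace component is intended.
set_option linter.dupNamespace false

noncomputable section

namespace Summit.ValiantsHypothesis.ValiantsHypothesis.Theorems

open Literature.Computability.AlgebraicComplexity

/-! ### Values of a prefix persist -/

/-- Appending gates does not change the values of the earlier gates: the old value list is a
prefix of the new one (Bürgisser 2000, Def. 2.1). [folklore] -/
theorem rowScanProg_gateValues_prefix {k : Type*} [CommSemiring k] {σ : Type*}
    (G M : List (ArithCircuit.Gate k σ)) :
    ArithCircuit.gateValues G <+: ArithCircuit.gateValues (G ++ M) := by
  induction M using List.reverseRecOn with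
  | nil => simp
  | append_singleton M g ih =>
    rw [← List.append_assoc, ArithCircuit.gateValues_append_singleton]
    exact ih.trans (List.prefix_append _ _)

/-- The value of an earlier gate is unchanged by appending gates. [folklore] -/
theorem rowScanProg_getD_append {k : Type*} [CommSemiring k] {σ : Type*}
    (G M : List (ArithCircuit.Gate k σ)) {j : ℕ} (hj : j < G.length) :
    (ArithCircuit.gateValues (G ++ M)).getD j 0 = (ArithCircuit.gateValues G).getD j 0 := by
  obtain ⟨ws, hws⟩ := rowScanProg_gateValues_prefix G M
  rw [← hws, List.getD_eq_getElem?_getD, List.getD_eq_getElem?_getD,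
    List.getElem?_append_left (by rwa [ArithCircuit.gateValues_length])]

/-- The value of a freshly appended gate is its evaluation against the earlier values.
[folklore] -/
theorem rowScanProg_getD_length {k : Type*} [CommSemiring k] {σ : Type*}
    (G : List (ArithCircuit.Gate k σ)) (g : ArithCircuit.Gate k σ) :
    (ArithCircuit.gateValues (G ++ [g])).getD G.length 0 =
      g.eval (ArithCircuit.gateValues G) := by
  rw [ArithCircuit.gateValues_append_singleton, List.getD_eq_getElem?_getD,
    List.getElem?_append_right (by rw [ArithCircuit.gateValues_length]),
    ArithCircuit.gateValues_length, Nat.sub_self, List.getElem?_cons_zero, Option.getD_some]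

/-- A value provided at an index `≥ l₀` stays provided after appending gates. [folklore] -/
theorem rowScanProg_prov_mono {k : Type*} [CommSemiring k] {σ : Type*}
    {G G' : List (ArithCircuit.Gate k σ)} (h : G <+: G') {l₀ : ℕ} {v : MvPolynomial σ k}
    (hv : ∃ j, l₀ ≤ j ∧ j < G.length ∧ (ArithCircuit.gateValues G).getD j 0 = v) :
    ∃ j, l₀ ≤ j ∧ j < G'.length ∧ (ArithCircuit.gateValues G').getD j 0 = v := by
  obtain ⟨M, rfl⟩ := h
  obtain ⟨j, h1, h2, h3⟩ := hv
  exact ⟨j, h1, by rw [List.length_append]; omega, by rw [rowScanProg_getD_append G M h2, h3]⟩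

/-! ### Admissible annotated gate lists: one more gate -/

/-- **One admissible step.** Appending to an admissible annotated gate list a non-nullary gate
of fan-in `≤ B` whose operands refer to earlier gates, whose operands (if it is a product gate)
have empty support, and whose value is invariant under ALL diagonal renamings, gives an
admissible annotated gate list. [folklore] -/
theorem rowScanProg_inv_step {n : ℕ} (K' : ℕ → Finset (Fin n)) (B : ℕ)
    (G : List (ArithCircuit.Gate ℂ (Fin n × Fin n))) (g : ArithCircuit.Gate ℂ (Fin n × Fin n))
    (hG : (∀ g ∈ G, g.args ≠ []) ∧ (∀ g ∈ G, g.fanIn ≤ B) ∧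
      (∀ (i : ℕ) (g : ArithCircuit.Gate ℂ (Fin n × Fin n)), G[i]? = some g →
        ∀ u ∈ g.args, u.RefsBelow i) ∧
      (∀ (i : ℕ) (us : List (ArithCircuit.Operand ℂ (Fin n × Fin n))),
        G[i]? = some (.prod us) → ∀ u ∈ us, SupportSymm.osupp K' u ⊆ K' i) ∧
      (∀ (i : ℕ) (σ : Equiv.Perm (Fin n)), i < G.length → (∀ x ∈ K' i, σ x = x) →
        MvPolynomial.rename (fun pq : Fin n × Fin n => (σ pq.1, σ pq.2))
          ((ArithCircuit.gateValues G).getD i 0) = (ArithCircuit.gateValues G).getD i 0))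
    (h1 : g.args ≠ []) (h2 : g.fanIn ≤ B)
    (h3 : ∀ u ∈ g.args, u.RefsBelow G.length)
    (h4 : ∀ us, g = .prod us → ∀ u ∈ us, SupportSymm.osupp K' u = ∅)
    (h5 : ∀ σ : Equiv.Perm (Fin n),
      MvPolynomial.rename (fun pq : Fin n × Fin n => (σ pq.1, σ pq.2))
        (g.eval (ArithCircuit.gateValues G)) = g.eval (ArithCircuit.gateValues G)) :
    (∀ g' ∈ G ++ [g], g'.args ≠ []) ∧ (∀ g' ∈ G ++ [g], g'.fanIn ≤ B) ∧
      (∀ (i : ℕ) (g' : ArithCircuit.Gate ℂ (Fin n × Fin n)), (G ++ [g])[i]? = some g' →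
        ∀ u ∈ g'.args, u.RefsBelow i) ∧
      (∀ (i : ℕ) (us : List (ArithCircuit.Operand ℂ (Fin n × Fin n))),
        (G ++ [g])[i]? = some (.prod us) → ∀ u ∈ us, SupportSymm.osupp K' u ⊆ K' i) ∧
      (∀ (i : ℕ) (σ : Equiv.Perm (Fin n)), i < (G ++ [g]).length → (∀ x ∈ K' i, σ x = x) →
        MvPolynomial.rename (fun pq : Fin n × Fin n => (σ pq.1, σ pq.2))
          ((ArithCircuit.gateValues (G ++ [g])).getD i 0) =
          (ArithCircuit.gateValues (G ++ [g])).getD i 0) := by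
  obtain ⟨hG1, hG2, hG3, hG4, hG5⟩ := hG
  -- the new gate sits at index `G.length`
  have hget : ∀ (i : ℕ) (g' : ArithCircuit.Gate ℂ (Fin n × Fin n)), (G ++ [g])[i]? = some g' →
      G[i]? = some g' ∨ (i = G.length ∧ g' = g) := by
    intro i g' hi
    rcases Nat.lt_or_ge i G.length with h | h
    · left
      rwa [List.getElem?_append_left h] at hi
    · right
      have hlt := (List.getElem?_eq_some_iff.mp hi).1
      rw [List.length_append, List.length_singleton] at hlt
      obtain rfl : i = G.length := by omega
      rw [List.getElem?_concat_length] at hi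
      exact ⟨rfl, (Option.some.inj hi).symm⟩
  refine ⟨?_, ?_, ?_, ?_, ?_⟩
  · intro g' hg'
    rw [List.mem_append, List.mem_singleton] at hg'
    rcases hg' with hg' | rfl
    exacts [hG1 g' hg', h1]
  · intro g' hg'
    rw [List.mem_append, List.mem_singleton] at hg'
    rcases hg' with hg' | rfl
    exacts [hG2 g' hg', h2]
  · intro i g' hi
    rcases hget i g' hi with hi | ⟨rfl, rfl⟩
    exacts [hG3 i g' hi, h3]
  · intro i us hi
    rcases hget i _ hi with hi | ⟨rfl, h⟩
    · exact hG4 i us hi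
    · intro u hu
      rw [h4 us h.symm u hu]
      exact Finset.empty_subset _
  · intro i σ hi hfix
    rw [List.length_append, List.length_singleton] at hi
    rcases Nat.lt_or_ge i G.length with h | h
    · rw [rowScanProg_getD_append G [g] h]
      exact hG5 i σ h hfix
    · obtain rfl : i = G.length := by omega
      rw [rowScanProg_getD_length]
      exact h5 σ

/-! ### Providing values by one more gate -/

/-- **An invariant weighted sum of earlier gates.** One more (sum) gate, of fan-in `#ι + 1`,
provides `Σ_t c_t • v_{j_t}` for earlier gates `j_t`, as soon as this sum is invariant under all
diagonal renamings. [folklore] -/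
theorem rowScanProg_provide_sum {n : ℕ} (K' : ℕ → Finset (Fin n)) (B l₀ : ℕ)
    {ι : Type*} [Fintype ι] (hB : Fintype.card ι + 1 ≤ B) (c : ι → ℂ) (jx : ι → ℕ)
    (G : List (ArithCircuit.Gate ℂ (Fin n × Fin n))) (hl : l₀ ≤ G.length)
    (hG : (∀ g ∈ G, g.args ≠ []) ∧ (∀ g ∈ G, g.fanIn ≤ B) ∧
      (∀ (i : ℕ) (g : ArithCircuit.Gate ℂ (Fin n × Fin n)), G[i]? = some g →
        ∀ u ∈ g.args, u.RefsBelow i) ∧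
      (∀ (i : ℕ) (us : List (ArithCircuit.Operand ℂ (Fin n × Fin n))),
        G[i]? = some (.prod us) → ∀ u ∈ us, SupportSymm.osupp K' u ⊆ K' i) ∧
      (∀ (i : ℕ) (σ : Equiv.Perm (Fin n)), i < G.length → (∀ x ∈ K' i, σ x = x) →
        MvPolynomial.rename (fun pq : Fin n × Fin n => (σ pq.1, σ pq.2))
          ((ArithCircuit.gateValues G).getD i 0) = (ArithCircuit.gateValues G).getD i 0))
    (hjx : ∀ t, jx t < G.length)
    (hinv : ∀ σ : Equiv.Perm (Fin n),
      MvPolynomial.rename (fun pq : Fin n × Fin n => (σ pq.1, σ pq.2))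
        (∑ t, c t • (ArithCircuit.gateValues G).getD (jx t) 0) =
        ∑ t, c t • (ArithCircuit.gateValues G).getD (jx t) 0) :
    ∃ G' : List (ArithCircuit.Gate ℂ (Fin n × Fin n)), G <+: G' ∧
      ((∀ g ∈ G', g.args ≠ []) ∧ (∀ g ∈ G', g.fanIn ≤ B) ∧
        (∀ (i : ℕ) (g : ArithCircuit.Gate ℂ (Fin n × Fin n)), G'[i]? = some g →
          ∀ u ∈ g.args, u.RefsBelow i) ∧
        (∀ (i : ℕ) (us : List (ArithCircuit.Operand ℂ (Fin n × Fin n))),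
          G'[i]? = some (.prod us) → ∀ u ∈ us, SupportSymm.osupp K' u ⊆ K' i) ∧
        (∀ (i : ℕ) (σ : Equiv.Perm (Fin n)), i < G'.length → (∀ x ∈ K' i, σ x = x) →
          MvPolynomial.rename (fun pq : Fin n × Fin n => (σ pq.1, σ pq.2))
            ((ArithCircuit.gateValues G').getD i 0) = (ArithCircuit.gateValues G').getD i 0)) ∧
      G'.length = G.length + 1 ∧
      ∃ j, l₀ ≤ j ∧ j < G'.length ∧ (ArithCircuit.gateValues G').getD j 0 =
        ∑ t, c t • (ArithCircuit.gateValues G).getD (jx t) 0 := by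
  classical
  obtain ⟨g, hg⟩ : ∃ g : ArithCircuit.Gate ℂ (Fin n × Fin n), g = .sum (((0 : ℂ), .const 0) ::
    (Finset.univ : Finset ι).toList.map fun t => (c t, .gate (jx t))) := ⟨_, rfl⟩
  have hval : g.eval (ArithCircuit.gateValues G) =
      ∑ t, c t • (ArithCircuit.gateValues G).getD (jx t) 0 := by
    simp [hg, ArithCircuit.Gate.eval, ArithCircuit.Operand.eval, List.map_map, Function.comp_def,
      Finset.sum_map_toList]
  refine ⟨G ++ [g], List.prefix_append _ _, ?_, by simp, G.length, hl, by simp,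
    by rw [rowScanProg_getD_length, hval]⟩
  refine rowScanProg_inv_step K' B G g hG ?_ ?_ ?_ ?_ ?_
  · simp [hg, ArithCircuit.Gate.args]
  · simp only [hg, ArithCircuit.Gate.fanIn, ArithCircuit.Gate.args, List.map_cons, List.map_map,
      List.length_cons, List.length_map, Finset.length_toList, Finset.card_univ]
    omega
  · intro u hu
    simp only [hg, ArithCircuit.Gate.args, List.map_cons, List.map_map, List.mem_cons,
      List.mem_map, Function.comp_apply, Finset.mem_toList, Finset.mem_univ, true_and] at hu
    rcases hu with rfl | ⟨t, rfl⟩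
    · trivial
    · exact hjx t
  · intro us h
    rw [hg] at h
    cases h
  · intro σ
    rw [hval]
    exact hinv σ

/-- **A weighted sum of provided values.** One more gate, of fan-in `#ι + 1`, provides
`Σ_t c_t • v_t` when every `v_t` is provided at an index `≥ l₀` (empty support, hence invariant
under all diagonal renamings). [folklore] -/
theorem rowScanProg_provide_wsum {n : ℕ} (K' : ℕ → Finset (Fin n)) (B l₀ : ℕ)
    (hK' : ∀ j, l₀ ≤ j → K' j = ∅) {ι : Type*} [Fintype ι] (hB : Fintype.card ι + 1 ≤ B)
    (c : ι → ℂ) (v : ι → MvPolynomial (Fin n × Fin n) ℂ)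
    (G : List (ArithCircuit.Gate ℂ (Fin n × Fin n))) (hl : l₀ ≤ G.length)
    (hG : (∀ g ∈ G, g.args ≠ []) ∧ (∀ g ∈ G, g.fanIn ≤ B) ∧
      (∀ (i : ℕ) (g : ArithCircuit.Gate ℂ (Fin n × Fin n)), G[i]? = some g →
        ∀ u ∈ g.args, u.RefsBelow i) ∧
      (∀ (i : ℕ) (us : List (ArithCircuit.Operand ℂ (Fin n × Fin n))),
        G[i]? = some (.prod us) → ∀ u ∈ us, SupportSymm.osupp K' u ⊆ K' i) ∧
      (∀ (i : ℕ) (σ : Equiv.Perm (Fin n)), i < G.length → (∀ x ∈ K' i, σ x = x) →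
        MvPolynomial.rename (fun pq : Fin n × Fin n => (σ pq.1, σ pq.2))
          ((ArithCircuit.gateValues G).getD i 0) = (ArithCircuit.gateValues G).getD i 0))
    (hv : ∀ t, ∃ j, l₀ ≤ j ∧ j < G.length ∧ (ArithCircuit.gateValues G).getD j 0 = v t) :
    ∃ G' : List (ArithCircuit.Gate ℂ (Fin n × Fin n)), G <+: G' ∧
      ((∀ g ∈ G', g.args ≠ []) ∧ (∀ g ∈ G', g.fanIn ≤ B) ∧
        (∀ (i : ℕ) (g : ArithCircuit.Gate ℂ (Fin n × Fin n)), G'[i]? = some g →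
          ∀ u ∈ g.args, u.RefsBelow i) ∧
        (∀ (i : ℕ) (us : List (ArithCircuit.Operand ℂ (Fin n × Fin n))),
          G'[i]? = some (.prod us) → ∀ u ∈ us, SupportSymm.osupp K' u ⊆ K' i) ∧
        (∀ (i : ℕ) (σ : Equiv.Perm (Fin n)), i < G'.length → (∀ x ∈ K' i, σ x = x) →
          MvPolynomial.rename (fun pq : Fin n × Fin n => (σ pq.1, σ pq.2))
            ((ArithCircuit.gateValues G').getD i 0) = (ArithCircuit.gateValues G').getD i 0)) ∧
      G'.length = G.length + 1 ∧
      ∃ j, l₀ ≤ j ∧ j < G'.length ∧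
        (ArithCircuit.gateValues G').getD j 0 = ∑ t, c t • v t := by
  choose jx hjx using hv
  have hS : ∑ t, c t • (ArithCircuit.gateValues G).getD (jx t) 0 = ∑ t, c t • v t :=
    Finset.sum_congr rfl fun t _ => by rw [(hjx t).2.2]
  rw [← hS]
  refine rowScanProg_provide_sum K' B l₀ hB c jx G hl hG (fun t => (hjx t).2.1) fun σ => ?_
  rw [map_sum]
  refine Finset.sum_congr rfl fun t _ => ?_
  rw [map_smul, hG.2.2.2.2 (jx t) σ (hjx t).2.1 (by simp [hK' _ (hjx t).1])]

/-- **A product of two provided values.** One more (product) gate of fan-in `2` provides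
`p * q`; its operands have empty support, so supports stay hereditary. [folklore] -/
theorem rowScanProg_provide_prod {n : ℕ} (K' : ℕ → Finset (Fin n)) (B l₀ : ℕ)
    (hK' : ∀ j, l₀ ≤ j → K' j = ∅) (hB : 2 ≤ B)
    (G : List (ArithCircuit.Gate ℂ (Fin n × Fin n))) (hl : l₀ ≤ G.length)
    (hG : (∀ g ∈ G, g.args ≠ []) ∧ (∀ g ∈ G, g.fanIn ≤ B) ∧
      (∀ (i : ℕ) (g : ArithCircuit.Gate ℂ (Fin n × Fin n)), G[i]? = some g →
        ∀ u ∈ g.args, u.RefsBelow i) ∧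
      (∀ (i : ℕ) (us : List (ArithCircuit.Operand ℂ (Fin n × Fin n))),
        G[i]? = some (.prod us) → ∀ u ∈ us, SupportSymm.osupp K' u ⊆ K' i) ∧
      (∀ (i : ℕ) (σ : Equiv.Perm (Fin n)), i < G.length → (∀ x ∈ K' i, σ x = x) →
        MvPolynomial.rename (fun pq : Fin n × Fin n => (σ pq.1, σ pq.2))
          ((ArithCircuit.gateValues G).getD i 0) = (ArithCircuit.gateValues G).getD i 0))
    {p q : MvPolynomial (Fin n × Fin n) ℂ}
    (hp : ∃ j, l₀ ≤ j ∧ j < G.length ∧ (ArithCircuit.gateValues G).getD j 0 = p)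
    (hq : ∃ j, l₀ ≤ j ∧ j < G.length ∧ (ArithCircuit.gateValues G).getD j 0 = q) :
    ∃ G' : List (ArithCircuit.Gate ℂ (Fin n × Fin n)), G <+: G' ∧
      ((∀ g ∈ G', g.args ≠ []) ∧ (∀ g ∈ G', g.fanIn ≤ B) ∧
        (∀ (i : ℕ) (g : ArithCircuit.Gate ℂ (Fin n × Fin n)), G'[i]? = some g →
          ∀ u ∈ g.args, u.RefsBelow i) ∧
        (∀ (i : ℕ) (us : List (ArithCircuit.Operand ℂ (Fin n × Fin n))),
          G'[i]? = some (.prod us) → ∀ u ∈ us, SupportSymm.osupp K' u ⊆ K' i) ∧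
        (∀ (i : ℕ) (σ : Equiv.Perm (Fin n)), i < G'.length → (∀ x ∈ K' i, σ x = x) →
          MvPolynomial.rename (fun pq : Fin n × Fin n => (σ pq.1, σ pq.2))
            ((ArithCircuit.gateValues G').getD i 0) = (ArithCircuit.gateValues G').getD i 0)) ∧
      G'.length = G.length + 1 ∧
      ∃ j, l₀ ≤ j ∧ j < G'.length ∧ (ArithCircuit.gateValues G').getD j 0 = p * q := by
  obtain ⟨jp, hp1, hp2, hp3⟩ := hp
  obtain ⟨jq, hq1, hq2, hq3⟩ := hq
  have hval : (ArithCircuit.Gate.prod [.gate jp, .gate jq] :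
      ArithCircuit.Gate ℂ (Fin n × Fin n)).eval (ArithCircuit.gateValues G) = p * q := by
    simp only [ArithCircuit.Gate.eval, List.map_cons, List.map_nil, List.prod_cons, List.prod_nil,
      mul_one, ArithCircuit.Operand.eval_gate, hp3, hq3]
  refine ⟨G ++ [.prod [.gate jp, .gate jq]], List.prefix_append _ _, ?_, by simp, G.length, hl,
    by simp, by rw [rowScanProg_getD_length, hval]⟩
  refine rowScanProg_inv_step K' B G _ hG (by simp [ArithCircuit.Gate.args])
    (by simpa [ArithCircuit.Gate.fanIn, ArithCircuit.Gate.args] using hB) ?_ ?_ ?_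
  · intro u hu
    simp only [ArithCircuit.Gate.args, List.mem_cons, List.not_mem_nil, or_false] at hu
    rcases hu with rfl | rfl
    exacts [hp2, hq2]
  · intro us h u hu
    cases h
    simp only [List.mem_cons, List.not_mem_nil, or_false] at hu
    rcases hu with rfl | rfl
    exacts [hK' jp hp1, hK' jq hq1]
  · intro σ
    have h5 := hG.2.2.2.2
    have ip := h5 jp σ hp2 (by simp [hK' jp hp1])
    have iq := h5 jq σ hq2 (by simp [hK' jq hq1])
    rw [hp3] at ip
    rw [hq3] at iq
    rw [hval, map_mul, ip, iq]

/-- **A constant.** One more gate `c • (const 1)` of fan-in `1` provides `C c`. [folklore] -/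
theorem rowScanProg_provide_const {n : ℕ} (K' : ℕ → Finset (Fin n)) (B l₀ : ℕ) (hB : 1 ≤ B)
    (G : List (ArithCircuit.Gate ℂ (Fin n × Fin n))) (hl : l₀ ≤ G.length)
    (hG : (∀ g ∈ G, g.args ≠ []) ∧ (∀ g ∈ G, g.fanIn ≤ B) ∧
      (∀ (i : ℕ) (g : ArithCircuit.Gate ℂ (Fin n × Fin n)), G[i]? = some g →
        ∀ u ∈ g.args, u.RefsBelow i) ∧
      (∀ (i : ℕ) (us : List (ArithCircuit.Operand ℂ (Fin n × Fin n))),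
        G[i]? = some (.prod us) → ∀ u ∈ us, SupportSymm.osupp K' u ⊆ K' i) ∧
      (∀ (i : ℕ) (σ : Equiv.Perm (Fin n)), i < G.length → (∀ x ∈ K' i, σ x = x) →
        MvPolynomial.rename (fun pq : Fin n × Fin n => (σ pq.1, σ pq.2))
          ((ArithCircuit.gateValues G).getD i 0) = (ArithCircuit.gateValues G).getD i 0))
    (c : ℂ) :
    ∃ G' : List (ArithCircuit.Gate ℂ (Fin n × Fin n)), G <+: G' ∧
      ((∀ g ∈ G', g.args ≠ []) ∧ (∀ g ∈ G', g.fanIn ≤ B) ∧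
        (∀ (i : ℕ) (g : ArithCircuit.Gate ℂ (Fin n × Fin n)), G'[i]? = some g →
          ∀ u ∈ g.args, u.RefsBelow i) ∧
        (∀ (i : ℕ) (us : List (ArithCircuit.Operand ℂ (Fin n × Fin n))),
          G'[i]? = some (.prod us) → ∀ u ∈ us, SupportSymm.osupp K' u ⊆ K' i) ∧
        (∀ (i : ℕ) (σ : Equiv.Perm (Fin n)), i < G'.length → (∀ x ∈ K' i, σ x = x) →
          MvPolynomial.rename (fun pq : Fin n × Fin n => (σ pq.1, σ pq.2))
            ((ArithCircuit.gateValues G').getD i 0) = (ArithCircuit.gateValues G').getD i 0)) ∧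
      G'.length = G.length + 1 ∧
      ∃ j, l₀ ≤ j ∧ j < G'.length ∧
        (ArithCircuit.gateValues G').getD j 0 = MvPolynomial.C c := by
  have hval : (ArithCircuit.Gate.sum [(c, .const 1)] :
      ArithCircuit.Gate ℂ (Fin n × Fin n)).eval (ArithCircuit.gateValues G) = MvPolynomial.C c := by
    simp [ArithCircuit.Gate.eval, ArithCircuit.Operand.eval, MvPolynomial.smul_eq_C_mul]
  refine ⟨G ++ [.sum [(c, .const 1)]], List.prefix_append _ _, ?_, by simp, G.length, hl,
    by simp, by rw [rowScanProg_getD_length, hval]⟩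
  refine rowScanProg_inv_step K' B G _ hG (by simp [ArithCircuit.Gate.args])
    (by simpa [ArithCircuit.Gate.fanIn, ArithCircuit.Gate.args] using hB) ?_ ?_ ?_
  · intro u hu
    simp only [ArithCircuit.Gate.args, List.map_cons, List.map_nil, List.mem_cons,
      List.not_mem_nil, or_false] at hu
    subst hu
    trivial
  · intro us h
    cases h
  · intro σ
    rw [hval, MvPolynomial.rename_C]

/-! ### Composing one-gate steps -/

/-- **Finitely many one-gate steps compose.** For any property `Inv` of gate lists and any
notion `Prov G e` ("`G` provides item `e`") that persists under extension: if from every `Inv`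
extension of `G` one more gate provides `e` (for each `e : κ`), then some `Inv` extension of `G`
by at most `#κ` gates provides every `e` (induction on a finite set). [folklore] -/
theorem rowScanProg_provide_family {α : Type*} {κ : Type*} [Fintype κ] (Inv : List α → Prop)
    (Prov : List α → κ → Prop)
    (hmono : ∀ (G G' : List α) (e : κ), G <+: G' → Prov G e → Prov G' e)
    (G : List α) (hG : Inv G)
    (hstep : ∀ G₁ : List α, G <+: G₁ → Inv G₁ → ∀ e : κ,
      ∃ G₂ : List α, G₁ <+: G₂ ∧ Inv G₂ ∧ G₂.length = G₁.length + 1 ∧ Prov G₂ e) :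
    ∃ G' : List α, G <+: G' ∧ Inv G' ∧ G'.length ≤ G.length + Fintype.card κ ∧
      ∀ e, Prov G' e := by
  classical
  suffices h : ∀ s : Finset κ, ∃ G' : List α, G <+: G' ∧ Inv G' ∧
      G'.length ≤ G.length + s.card ∧ ∀ e ∈ s, Prov G' e by
    obtain ⟨G', h1, h2, h3, h4⟩ := h Finset.univ
    exact ⟨G', h1, h2, by rwa [Finset.card_univ] at h3, fun e => h4 e (Finset.mem_univ e)⟩
  intro s
  induction s using Finset.induction_on with
  | empty => exact ⟨G, List.prefix_rfl, hG, by simp, fun e he => absurd he (Finset.notMem_empty e)⟩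
  | insert e s he ih =>
    obtain ⟨G₁, h1, h2, h3, h4⟩ := ih
    obtain ⟨G₂, k1, k2, k3, k4⟩ := hstep G₁ h1 h2 e
    refine ⟨G₂, h1.trans k1, k2, by rw [Finset.card_insert_of_notMem he]; omega, fun e' he' => ?_⟩
    rw [Finset.mem_insert] at he'
    rcases he' with rfl | he'
    exacts [k4, hmono G₁ G₂ e' k1 (h4 e' he')]

end Summit.ValiantsHypothesis.ValiantsHypothesis.Theorems

end
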